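import Summits.ValiantsHypothesis.ValiantsHypothesis.Theorems.SymPencilPerFourSixDimNoJointFamily
import Summits.ValiantsHypothesis.ValiantsHypothesis.Theorems.SymPencilSdcPerFourTwentySix
import Summits.ValiantsHypothesis.ValiantsHypothesis.Theorems.SymPencilSdcPerFourTwentyNine

/-!
# Route `SymPencil` — `sdc(per_4) ≥ 26` UNCONDITIONALLY; the window `26 ≤ sdc(per₄) ≤ 29`
# (`--supports` stmt-ValiantsHypothesis-5674 `SdcSuperquadratic`; rung currency only — nothing
# here bears on `VP ≠ VNP`)

`SymPencilSdcPerFourTwentySix.twentySix_le_of_H106₅` proved `26 ≤ m` for every symmetric affine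
determinantal representation of `per_4` of size `m` (characteristic `0`) modulo the cell
hypothesis `H106₅`: no `6`-dimensional `V ⊆ Sing Z(per_4)` (all `3 × 3` subpermanents vanish on
`V`) carries a joint family of five squares of bilinear forms as `s²`-coefficients.  `H106₅` is
the instance `d = 5` of `SymPencilPerFourSixDimNoJointFamily.noJointFamily_six` (val-width-5674-p3
g2: the dimension-`6` trichotomy — proportional pair, zero cell, toric — under row and column
minors).  Composing the two:

**Theorem** (`twentySix_le_of_isSymm_isAffineDetRepr_perPoly_four`).  Over a field of
characteristic `0`, every symmetric affine determinantal representation of `per_4` has size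
`≥ 26`; equivalently (`sdc_perPoly_four_window_twentySix`) `26 ≤ sdc(per₄) ≤ 29` (upper bound:
the explicit pencil of `SymPencilSdcPerFourTwentyNine`).  Tree before: `25 ≤ sdc(per₄) ≤ 29`.

**Corollary** (`eq_twentySix_and_oneRowKernel_of_le_twentySix`).  A representation of size
`m ≤ 26` has `m = 26`, kernel-row rank `dim im bL = 12` and a `4`-dimensional kernel inside ONE
ROW or ONE COLUMN of `K^{4×4}` (`SymPencilSdcPerFourTwentySixCells.oneRow_of_le_twentySix` with
`H106₅` discharged) — so `sdc(per₄) = 26` iff such a one-row pencil of size `26` exists, else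
`sdc(per₄) ≥ 27`.

Honest framing: rung currency for the cell val-width; the crux `SdcSuperquadratic`
(super-quadratic growth of `sdc(per_n)`) and `VP ≠ VNP` are untouched.  No definitions, no named
facts, no hypotheses beyond the theorem statements. [folklore]
-/

noncomputable section

-- single-conjunct layout: Sub = Summit, duplicated namespace component intended
set_option linter.dupNamespace false

namespace Summit.ValiantsHypothesis.ValiantsHypothesis.Theorems.SymPencilSdcPerFourTwentySixWindow

open Matrix MvPolynomial Module
open Literature.Computability.AlgebraicComplexity
open Summit.ValiantsHypothesis.ValiantsHypothesis.Theorems.SymPencilPerFourSixDimNoJointFamily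
open Summit.ValiantsHypothesis.ValiantsHypothesis.Theorems.SymPencilSdcPerFourTwentySix

variable (K : Type*) [Field K] [CharZero K]

/-- **`H106₅` holds**: no `6`-dimensional subspace of `4 × 4` matrices on which all `3 × 3`
subpermanents vanish carries a joint family of five squares of bilinear forms as the
`s²`-coefficients of `per_4 (u + s y)` (`noJointFamily_six` at `d = 5`). [folklore] -/
theorem H106_five (V : Submodule K (Fin 4 × Fin 4 → K))
    (hV3 : ∀ x ∈ V, ∀ (r c : Fin 3 → Fin 4), Function.Injective r → Function.Injective c →
      ((Matrix.of fun i j => x (i, j)).submatrix r c).permanent = 0)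
    (h6 : finrank K V = 6) (c : Fin 5 → K)
    (β : Fin 5 → ((Fin 4 × Fin 4 → K) →ₗ[K] (Fin 4 × Fin 4 → K) →ₗ[K] K)) :
    ¬ (∀ u : Fin 4 × Fin 4 → K, ∀ y ∈ V, ∃ e₀ e₁ : K, ∀ s : K,
        eval (u + s • y) (perPoly (Fin 4) K) = e₀ + s * e₁ + s ^ 2 * ∑ k, c k * (β k u y) ^ 2) :=
  noJointFamily_six (by norm_num) V hV3 h6 c β

/-- **`sdc(per_4) ≥ 26`** over any field of characteristic `0` (unconditional): a symmetric affine
determinantal representation of `per_4` of size `m` has `26 ≤ m` — ten more than the number of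
variables (tree before: `25`). [folklore] -/
theorem twentySix_le_of_isSymm_isAffineDetRepr_perPoly_four
    {m : ℕ} {A : Matrix (Fin m) (Fin m) (MvPolynomial (Fin 4 × Fin 4) K)} (hS : A.IsSymm)
    (hA : IsAffineDetRepr (perPoly (Fin 4) K) A) : 26 ≤ m :=
  twentySix_le_of_H106₅ K (H106_five K) hS hA

/-- **No symmetric affine determinantal representation of `per_4` has size `≤ 25`**
(characteristic `0`). [folklore] -/
theorem false_of_isSymm_isAffineDetRepr_perPoly_four_le_twentyFive {m : ℕ} (hm : m ≤ 25)
    {A : Matrix (Fin m) (Fin m) (MvPolynomial (Fin 4 × Fin 4) K)} (hS : A.IsSymm)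
    (hA : IsAffineDetRepr (perPoly (Fin 4) K) A) : False :=
  false_of_le_twentyFive_of_H106₅ K (H106_five K) hm hS hA

/-- **`sdc(per_4) ≥ 4² + 10`** over `ℂ`, in the language of the route `SymPencil`. [folklore] -/
theorem sq_add_ten_le_of_isSymm_isAffineDetRepr_perPoly_four (m : ℕ)
    (A : Matrix (Fin m) (Fin m) (MvPolynomial (Fin 4 × Fin 4) ℂ)) (hS : A.IsSymm)
    (hA : IsAffineDetRepr (perPoly (Fin 4) ℂ) A) : 4 ^ 2 + 10 ≤ m :=
  twentySix_le_of_isSymm_isAffineDetRepr_perPoly_four ℂ hS hA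

/-- **`26 ≤ sdc(per₄)`** over any field of characteristic `0` (unconditional). [folklore] -/
theorem sdc_perPoly_four_twentySix_le :
    26 ≤ symmDeterminantalComplexity (perPoly (Fin 4) K) :=
  sdc_perPoly_four_twentySix_le_of_H106₅ K (H106_five K)

/-- **The window `26 ≤ sdc(per₄) ≤ 29`** over any field of characteristic `0`: the lower bound is
this file's rung, the upper bound the explicit pencil of `SymPencilSdcPerFourTwentyNine`.
[folklore] -/
theorem sdc_perPoly_four_window_twentySix :
    26 ≤ symmDeterminantalComplexity (perPoly (Fin 4) K) ∧
      symmDeterminantalComplexity (perPoly (Fin 4) K) ≤ 29 :=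
  ⟨sdc_perPoly_four_twentySix_le K,
    SymPencilSdcPerFourTwentyNine.sdc_perPoly_four_le_twentyNine K two_ne_zero⟩

/-- The complex instance: `26 ≤ sdc(per₄) ≤ 29` over `ℂ`. [folklore] -/
theorem sdc_perPoly_four_window_twentySix_complex :
    26 ≤ symmDeterminantalComplexity (perPoly (Fin 4) ℂ) ∧
      symmDeterminantalComplexity (perPoly (Fin 4) ℂ) ≤ 29 :=
  sdc_perPoly_four_window_twentySix ℂ

/-- **Size `≤ 26` forces size `26` with a one-row (one-column) kernel package — unconditionally.**
A symmetric affine determinantal representation of `per_4` of size `m ≤ 26` (characteristic `0`)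
has `m = 26`, and its base-point package has kernel-row rank `dim im bL = 12` and a
`4`-dimensional kernel `ker bL` contained in one row or one column of `K^{4×4}`
(`SymPencilSdcPerFourTwentySixCells.oneRow_of_le_twentySix` with `H106₅` discharged, sharpened
by `twentySix_le_of_isSymm_isAffineDetRepr_perPoly_four`). [folklore] -/
theorem eq_twentySix_and_oneRowKernel_of_le_twentySix
    {m : ℕ} (hm : m ≤ 26) {A : Matrix (Fin m) (Fin m) (MvPolynomial (Fin 4 × Fin 4) K)}
    (hS : A.IsSymm) (hA : IsAffineDetRepr (perPoly (Fin 4) K) A) :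
    m = 26 ∧
    ∃ (i₀ : Fin m) (D : Matrix {i // i ≠ i₀} {i // i ≠ i₀} K)
      (bL : (Fin 4 × Fin 4 → K) →ₗ[K] ({i // i ≠ i₀} → K))
      (CL : (Fin 4 × Fin 4 → K) →ₗ[K] Matrix {i // i ≠ i₀} {i // i ≠ i₀} K) (κ : K),
      IsUnit D.det ∧ Dᵀ = D ∧ (∀ z, (CL z)ᵀ = CL z) ∧ κ ≠ 0 ∧
      (∀ z, bL z ⬝ᵥ D⁻¹ *ᵥ bL z = 0) ∧
      (∀ z, bL z ⬝ᵥ (D⁻¹ * CL z * D⁻¹) *ᵥ bL z = 0) ∧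
      (∀ z, D.det * (bL z ⬝ᵥ (D⁻¹ * CL z * D⁻¹ * CL z * D⁻¹) *ᵥ bL z) =
        -(κ * eval z (perPoly (Fin 4) K))) ∧
      finrank K (LinearMap.range bL) = 12 ∧ finrank K (LinearMap.ker bL) = 4 ∧
      ((∃ l : Fin 4, ∀ x ∈ LinearMap.ker bL, ∀ i j : Fin 4, i ≠ l → x (i, j) = 0) ∨
       (∃ c : Fin 4, ∀ x ∈ LinearMap.ker bL, ∀ i j : Fin 4, j ≠ c → x (i, j) = 0)) := by
  have h26 := twentySix_le_of_isSymm_isAffineDetRepr_perPoly_four K hS hA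
  exact ⟨le_antisymm hm h26,
    (SymPencilSdcPerFourTwentySixCells.oneRow_of_le_twentySix K (H106_five K) hm hS hA).2⟩

end Summit.ValiantsHypothesis.ValiantsHypothesis.Theorems.SymPencilSdcPerFourTwentySixWindow

end
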